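import Mathlib.Analysis.SpecificLimits.Basic
import Mathlib.Analysis.Complex.Basic
import Mathlib.NumberTheory.Real.Irrational
import Mathlib.RingTheory.Algebraic.Basic
import Literature.NumberTheory.Transcendental.LindemannWeierstrassProofs
import HarnessLib

/-!
# Quadratic slope: finitely many integer points of `βN + c/N + o(1/N)` when `c·π² ∈ ℚ̄`

The `d = 2` case of the Galois-norm ("norm descent") lever for the residual cusp atoms of the crux
`RigidCore.SparsityTwo` (idea cards pell-orbit-analyticity-shapiro "Theorem P" and
galois-norm-branch-defect; line cusp-germ-schneider-sparsity, residual stub (★)): let `β` be a real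
QUADRATIC irrational (`β² = sβ + t`, `s, t ∈ ℚ`), `c ∈ ℂ` with `c·π²` algebraic (the period-graded
shape `c = a/(2πi)²`, `a ∈ ℚ̄`, of the first cusp Taylor coefficient), and `r N = o(1/N)`. Then
`βN + c/N + r N ∈ ℤ` for only finitely many `N` (`finite_setOf_quadratic_slope_hit`).

Proof. At a hit `L − βN = c/N + r_N =: ε_N`; with the conjugate `β' = s − β` the NORM
`(L − βN)(L − β'N) = L² − sLN − tN²` lies in `(1/D)ℤ` (`D` a common denominator of `s, t`) and
equals `ε_N (ε_N + (2β − s) N) → (2β − s) c`. An eventually-integral convergent sequence is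
eventually constant, equal to its limit `k/D` (`exists_int_eq_of_tendsto_of_frequently`): if
`k ≠ 0` then `c = k/(D(2β−s))` is algebraic and non-zero, so `π² = (cπ²)/c` would be algebraic
(Lindemann, tree `transcendental_pi_holds`); if `k = 0` then `(L − βN)(L − β'N) = 0` at every large
hit, i.e. `β` or `β'` is rational. Either way there are no large hits. This contains the
disprover's calibration pair `shapiroW` of `ExpPointsShapiroModel.lean` (slope `√2`, torsion
phases, `N² − 2M² → −4/π²`). [folklore]

## References

* [folklore] elementary; the bounded-norm step of Pell-type coincidence problems (cf.
  D'Aquino–Macintyre–Terzo, arXiv:1206.6747 §3, Ritt-simple cases of Shapiro's conjecture).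
-/

noncomputable section

open Filter
open _root_.Topology

namespace Literature.NumberTheory.Transcendental

/-- Two integers at (complex) distance `< 1` coincide. [folklore] -/
theorem Int.eq_of_norm_cast_sub_lt_one {M M' : ℤ} (h : ‖(M : ℂ) - (M' : ℂ)‖ < 1) : M = M' := by
  have : |(M - M' : ℤ)| < 1 := by
    rw [← Int.cast_sub, Complex.norm_intCast] at h
    exact_mod_cast h
  linarith [Int.abs_lt_one_iff.mp this]

/-- **An eventually-integral convergent sequence is eventually equal to its (integer) limit.**
If `a N → κ` in `ℂ` and `a N ∈ ℤ` for infinitely many `N`, then `κ = k ∈ ℤ` and every large `N`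
with `a N ∈ ℤ` has `a N = k`. [folklore] -/
theorem exists_int_eq_of_tendsto_of_frequently {a : ℕ → ℂ} {κ : ℂ}
    (ha : Tendsto a atTop (𝓝 κ)) (hfreq : ∃ᶠ N in atTop, ∃ M : ℤ, a N = M) :
    ∃ k : ℤ, (k : ℂ) = κ ∧ ∀ᶠ N in atTop, ∀ M : ℤ, a N = M → M = k := by
  have hev : ∀ δ : ℝ, 0 < δ → ∀ᶠ N in atTop, ‖a N - κ‖ < δ := by
    intro δ hδ
    have h := (ha.sub_const κ).norm
    rw [sub_self, norm_zero] at h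
    exact h.eventually (gt_mem_nhds hδ)
  obtain ⟨N₀, hN₀, M₀, hM₀⟩ := ((hev (1 / 4) (by norm_num)).and_frequently hfreq).exists
  have hdist : ∀ {N : ℕ} {M : ℤ}, a N = M → ‖(M : ℂ) - M₀‖ ≤ ‖a N - κ‖ + ‖a N₀ - κ‖ := by
    intro N M hM
    calc ‖(M : ℂ) - M₀‖ = ‖(a N - κ) - (a N₀ - κ)‖ := by rw [hM, hM₀]; ring_nf
      _ ≤ ‖a N - κ‖ + ‖a N₀ - κ‖ := norm_sub_le _ _
  -- `κ = M₀`
  have hκ : (M₀ : ℂ) = κ := by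
    by_contra hne
    have hpos : 0 < ‖(M₀ : ℂ) - κ‖ := norm_pos_iff.mpr (sub_ne_zero.mpr hne)
    set δ : ℝ := min (‖(M₀ : ℂ) - κ‖) (1 / 4) with hδ
    have hδpos : 0 < δ := lt_min hpos (by norm_num)
    obtain ⟨N₁, hN₁, M₁, hM₁⟩ := ((hev δ hδpos).and_frequently hfreq).exists
    have h01 : M₁ = M₀ := by
      refine Int.eq_of_norm_cast_sub_lt_one ((hdist hM₁).trans_lt ?_)
      calc ‖a N₁ - κ‖ + ‖a N₀ - κ‖ < δ + 1 / 4 := add_lt_add hN₁ hN₀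
        _ ≤ 1 / 4 + 1 / 4 := by gcongr; exact min_le_right _ _
        _ < 1 := by norm_num
    have hlt : ‖(M₀ : ℂ) - κ‖ < δ := by rw [← h01, ← hM₁]; exact hN₁
    exact absurd (min_le_left _ _ : δ ≤ ‖(M₀ : ℂ) - κ‖) (not_le.mpr hlt)
  refine ⟨M₀, hκ, ?_⟩
  filter_upwards [hev (1 / 4) (by norm_num)] with N hN M hM
  refine Int.eq_of_norm_cast_sub_lt_one ((hdist hM).trans_lt ?_)
  calc ‖a N - κ‖ + ‖a N₀ - κ‖ < 1 / 4 + 1 / 4 := add_lt_add hN hN₀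
    _ < 1 := by norm_num

/-- A real quadratic irrationality is algebraic, together with its complexification.
[folklore] -/
theorem isAlgebraic_complex_of_sq_eq {β : ℝ} {s t : ℚ} (hquad : β ^ 2 = s * β + t) :
    IsAlgebraic ℚ (β : ℂ) := by
  refine ⟨Polynomial.X ^ 2 - Polynomial.C s * Polynomial.X - Polynomial.C t, ?_, ?_⟩
  · intro h0
    have := congrArg (Polynomial.coeff · 2) h0
    simp at this
  · have hq : (β : ℂ) ^ 2 = (s : ℂ) * β + (t : ℂ) := by
      have := congrArg (Complex.ofReal) hquad
      push_cast at this
      exact this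
    simp only [map_sub, map_mul, Polynomial.aeval_X_pow, Polynomial.aeval_C, Polynomial.aeval_X,
      eq_ratCast]
    rw [hq]; ring

/-- **Quadratic slope with a period-type coefficient has finitely many integer points.**
Let `β ∈ ℝ` be irrational with `β² = sβ + t` (`s, t ∈ ℚ`), `c ∈ ℂ` with `c·π²` algebraic over
`ℚ`, and `r : ℕ → ℂ` with `N · r N → 0`. Then `{N | βN + c/N + r N ∈ ℤ}` is finite. [folklore] -/
theorem finite_setOf_quadratic_slope_hit {β : ℝ} (hirr : Irrational β) {s t : ℚ}
    (hquad : β ^ 2 = s * β + t) {c : ℂ} (hc : IsAlgebraic ℚ (c * (Real.pi : ℂ) ^ 2))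
    {r : ℕ → ℂ} (hr : Tendsto (fun N : ℕ => (N : ℂ) * r N) atTop (𝓝 0)) :
    Set.Finite {N : ℕ | ∃ L : ℤ, (β : ℂ) * N + c / N + r N = L} := by
  -- a common denominator of `s, t`
  obtain ⟨D, hD, sD, tD, hsD, htD⟩ : ∃ D : ℕ, 0 < D ∧ ∃ sD tD : ℤ,
      (D : ℂ) * (s : ℂ) = sD ∧ (D : ℂ) * (t : ℂ) = tD := by
    refine ⟨s.den * t.den, Nat.pos_of_ne_zero (mul_ne_zero s.den_nz t.den_nz),
      s.num * t.den, t.num * s.den, ?_, ?_⟩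
    · have h := Rat.mul_den_eq_num s
      have h' : ((s.den : ℚ) * t.den * s : ℚ) = (s.num * t.den : ℚ) := by
        calc ((s.den : ℚ) * t.den * s : ℚ) = (s * s.den) * t.den := by ring
          _ = s.num * t.den := by rw [h]
      have := congrArg (Rat.cast : ℚ → ℂ) h'
      push_cast at this ⊢
      exact this
    · have h := Rat.mul_den_eq_num t
      have h' : ((s.den : ℚ) * t.den * t : ℚ) = (t.num * s.den : ℚ) := by
        calc ((s.den : ℚ) * t.den * t : ℚ) = (t * t.den) * s.den := by ring
          _ = t.num * s.den := by rw [h]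
      have := congrArg (Rat.cast : ℚ → ℂ) h'
      push_cast at this ⊢
      exact this
  have hq : (β : ℂ) ^ 2 = (s : ℂ) * β + (t : ℂ) := by
    have := congrArg (Complex.ofReal) hquad
    push_cast at this
    exact this
  have h2β : (2 * (β : ℂ) - (s : ℂ)) ≠ 0 := by
    intro h0
    apply hirr
    refine ⟨s / 2, ?_⟩
    have h1 : (2 * β - s : ℝ) = 0 := by
      have : ((2 * β - s : ℝ) : ℂ) = 0 := by push_cast; exact h0
      exact_mod_cast this
    push_cast
    linarith
  by_contra hinf
  have hfreqS : ∃ᶠ N : ℕ in atTop, ∃ L : ℤ, (β : ℂ) * N + c / N + r N = L :=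
    Nat.frequently_atTop_iff_infinite.mpr (Set.not_finite.mp hinf)
  -- the error `ε_N = c/N + r N → 0`, with `N ε_N → c`
  set ε : ℕ → ℂ := fun N => c / N + r N with hε
  have hinv : Tendsto (fun N : ℕ => (N : ℂ)⁻¹) atTop (𝓝 0) :=
    tendsto_inv_atTop_nhds_zero_nat
  have hr0 : Tendsto r atTop (𝓝 0) := by
    have h1 : Tendsto (fun N : ℕ => ((N : ℂ) * r N) * (N : ℂ)⁻¹) atTop (𝓝 (0 * 0)) :=
      hr.mul hinv
    rw [zero_mul] at h1
    refine h1.congr' ?_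
    filter_upwards [eventually_gt_atTop 0] with N hN
    have hN' : (N : ℂ) ≠ 0 := Nat.cast_ne_zero.mpr hN.ne'
    field_simp
  have hεlim : Tendsto ε atTop (𝓝 0) := by
    have h1 : Tendsto (fun N : ℕ => c * (N : ℂ)⁻¹) atTop (𝓝 (c * 0)) := hinv.const_mul c
    rw [mul_zero] at h1
    have := h1.add hr0
    rw [add_zero] at this
    simpa [hε, div_eq_mul_inv] using this
  have hNε : Tendsto (fun N : ℕ => (N : ℂ) * ε N) atTop (𝓝 c) := by
    have h1 : Tendsto (fun N : ℕ => c + (N : ℂ) * r N) atTop (𝓝 (c + 0)) := hr.const_add c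
    rw [add_zero] at h1
    refine h1.congr' ?_
    filter_upwards [eventually_gt_atTop 0] with N hN
    have hN' : (N : ℂ) ≠ 0 := Nat.cast_ne_zero.mpr hN.ne'
    simp only [hε]
    field_simp
  -- the norm sequence and its limit
  set a : ℕ → ℂ := fun N => (D : ℂ) * (ε N * (ε N + (2 * (β : ℂ) - (s : ℂ)) * N)) with ha
  set κ : ℂ := (D : ℂ) * ((2 * (β : ℂ) - (s : ℂ)) * c) with hκ
  have halim : Tendsto a atTop (𝓝 κ) := by
    have h1 : Tendsto (fun N => ε N * ε N + (2 * (β : ℂ) - (s : ℂ)) * ((N : ℂ) * ε N)) atTop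
        (𝓝 (0 * 0 + (2 * (β : ℂ) - (s : ℂ)) * c)) :=
      (hεlim.mul hεlim).add (hNε.const_mul _)
    have h2 := h1.const_mul (D : ℂ)
    rw [zero_mul, zero_add] at h2
    refine h2.congr fun N => ?_
    simp only [ha]; ring
  -- at a hit, `a N` is the integer `D L² − (Ds) L N − (Dt) N²`
  have hint : ∀ (N : ℕ) (L : ℤ), (β : ℂ) * N + c / N + r N = L →
      a N = ((D : ℤ) * L ^ 2 - sD * L * N - tD * (N : ℤ) ^ 2 : ℤ) := by
    intro N L hL
    have hεN : ε N = (L : ℂ) - (β : ℂ) * N := by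
      simp only [hε]; rw [← hL]; ring
    have key : a N = (D : ℂ) * ((L : ℂ) ^ 2 - (s : ℂ) * L * N - (t : ℂ) * (N : ℂ) ^ 2) := by
      simp only [ha, hεN]
      have : ((L : ℂ) - (β : ℂ) * N) * ((L : ℂ) - (β : ℂ) * N + (2 * (β : ℂ) - (s : ℂ)) * N) =
          (L : ℂ) ^ 2 - (s : ℂ) * L * N + ((s : ℂ) * β - (β : ℂ) ^ 2) * (N : ℂ) ^ 2 := by ring
      rw [this, hq]; ring
    rw [key]
    push_cast
    rw [← hsD, ← htD]
    ring
  have hfreqa : ∃ᶠ N : ℕ in atTop, ∃ M : ℤ, a N = M := by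
    refine hfreqS.mono fun N hN => ?_
    obtain ⟨L, hL⟩ := hN
    exact ⟨_, hint N L hL⟩
  obtain ⟨k, hk, hevk⟩ := exists_int_eq_of_tendsto_of_frequently halim hfreqa
  by_cases hk0 : k = 0
  · -- `κ = 0`: the norm vanishes at every large hit, forcing `β` or `β'` rational
    subst hk0
    obtain ⟨N, ⟨hNpos, hNk⟩, L, hL⟩ :=
      (((eventually_gt_atTop 0).and hevk).and_frequently hfreqS).exists
    have haN : a N = 0 := by
      have := hNk _ (hint N L hL)
      rw [hint N L hL, this, Int.cast_zero]
    have hN' : (N : ℂ) ≠ 0 := Nat.cast_ne_zero.mpr hNpos.ne'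
    have hεN : ε N = (L : ℂ) - (β : ℂ) * N := by
      simp only [hε]; rw [← hL]; ring
    have hprod : ((L : ℂ) - (β : ℂ) * N) * ((L : ℂ) - ((s : ℂ) - β) * N) = 0 := by
      have h0 : ε N * (ε N + (2 * (β : ℂ) - (s : ℂ)) * N) = 0 := by
        have hD' : (D : ℂ) ≠ 0 := Nat.cast_ne_zero.mpr hD.ne'
        have := haN
        simp only [ha] at this
        exact (mul_eq_zero.mp this).resolve_left hD'
      rw [hεN] at h0
      have : ((L : ℂ) - (β : ℂ) * N) * ((L : ℂ) - ((s : ℂ) - β) * N) =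
          ((L : ℂ) - (β : ℂ) * N) * ((L : ℂ) - (β : ℂ) * N + (2 * (β : ℂ) - (s : ℂ)) * N) := by ring
      rw [this, h0]
    rcases mul_eq_zero.mp hprod with h1 | h1
    · apply hirr
      refine ⟨(L : ℚ) / N, ?_⟩
      have h2 : (β : ℂ) = (L : ℂ) / N := by field_simp; linear_combination -h1
      have h3 : ((((L : ℚ) / N : ℚ) : ℝ) : ℂ) = ((β : ℝ) : ℂ) := by push_cast; rw [h2]
      exact_mod_cast h3
    · apply hirr
      refine ⟨s - (L : ℚ) / N, ?_⟩
      have h2 : (β : ℂ) = (s : ℂ) - (L : ℂ) / N := by field_simp; linear_combination h1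
      have h3 : (((s - (L : ℚ) / N : ℚ) : ℝ) : ℂ) = ((β : ℝ) : ℂ) := by push_cast; rw [h2]
      exact_mod_cast h3
  · -- `κ = k ≠ 0`: then `c` is algebraic and non-zero, so `π²` would be algebraic
    have hc_eq : c = (k : ℂ) / ((D : ℂ) * (2 * (β : ℂ) - (s : ℂ))) := by
      have hD' : (D : ℂ) ≠ 0 := Nat.cast_ne_zero.mpr hD.ne'
      rw [hk, hκ]
      field_simp
    have hβalg : IsAlgebraic ℚ (β : ℂ) := isAlgebraic_complex_of_sq_eq hquad
    have hsalg : IsAlgebraic ℚ (s : ℂ) := by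
      simpa using isAlgebraic_algebraMap (R := ℚ) (A := ℂ) s
    have hden : IsAlgebraic ℚ ((D : ℂ) * (2 * (β : ℂ) - (s : ℂ))) :=
      (isAlgebraic_nat D).mul (((isAlgebraic_nat 2).mul hβalg).sub hsalg)
    have hcalg : IsAlgebraic ℚ c := by
      rw [hc_eq, div_eq_mul_inv]
      exact (isAlgebraic_int k).mul (IsAlgebraic.inv_iff.mpr hden)
    have hc0 : c ≠ 0 := by
      rw [hc_eq]
      refine div_ne_zero (Int.cast_ne_zero.mpr hk0) (mul_ne_zero (Nat.cast_ne_zero.mpr hD.ne') h2β)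
    have hpi2 : IsAlgebraic ℚ ((Real.pi : ℂ) ^ 2) := by
      have : (Real.pi : ℂ) ^ 2 = (c * (Real.pi : ℂ) ^ 2) * c⁻¹ := by field_simp
      rw [this]
      exact hc.mul (IsAlgebraic.inv_iff.mpr hcalg)
    have hpiC : IsAlgebraic ℚ (Real.pi : ℂ) := hpi2.of_pow two_pos
    have hpiR : IsAlgebraic ℚ Real.pi :=
      (isAlgebraic_algebraMap_iff (R := ℚ) (A := ℂ) (algebraMap ℝ ℂ).injective).mp hpiC
    exact transcendental_pi_holds hpiR

end Literature.NumberTheory.Transcendental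

end
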